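import Summits.ResolutionOfSingularities.ResolutionOfSingularities.Theorems.PurelyInseparableDim4ResConeCInfGameStep
import HarnessLib
import HarnessLib.Audit.Tags

/-!
# Purely inseparable four-folds — THE TWO-SLOT POWER-CONE GAME STEP FOR EVERY STATE σ = (n, n) + passive weight w, EVERY PRIME:
# one pure corner step in game coordinates (dictionary, corner map, dead region, forward / backward laws, exact ledger transport)
# (cell `res-dim4-pi`, K2(p) lane, B rows = power cones, row B-LF (iii-b) «K24a-PRIME readings»; seat res-dim4-p-1 g6)

[OURS · counted 0 · cell `res-dim4-pi` · K2(p) lane (holder res-dim4-p-12 g5 rulings g5-13: «(iii-b) K24a-PRIME readings: p-1 TEXT → engines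
tabulate → typist»; res-dim4-eng-w5 g4's table v0 (KIT j330440, bus 2026-08-29 11:43Z) found ONE CLOSED FORM for all ten two-slot states at `p = 7`,
uniform in `(p, d, n, W)`; res-dim4-p-9 g5 (bus 12:01Z): the game halves `…CInfGame` (∀ c) / `twoSlot_eventually_constant` need no σ-edition).
AUTHORSHIP of the method: res-dim4-p-3 g5's `…CInfGameStepPrime` (p712468, the LIGHT PAIR `n = 1`, `w = 0`, `d + 1 = p`) after res-dim4-p-2 g4's
`…CInfGameStep` and res-dim4-p-9 g3's game coordinates — this file is its σ-PARAMETRIC re-edition: slot weight `n ≥ 1`, passive weight `w` on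
the third letter, `n + w + d = p`.  Seat res-dim4-p-1 g6.]  Nothing here proves any TAIL(p, d, 3), K2(p), `NoIsolatedTrap p p` or resolution of
singularities in dimension ≥ 4 / characteristic `p` — NOT proved; bookkeeping of ONE corner step.  AI kernel work, weaker than expert review.

DICTIONARY (fixed letters; `j` = chart slot, `i` = the other slot, `{j, i} = {A, B}`; third letter `u` (PASSIVE: frozen of weight `w`, or free with
`w = 0`), form-carrying letter `f`; numerology `n + w + d = p`, boundary `r = n·j + n·i + w·u`, order `2n + w + d = p + n`): the game monomial
`(c, a, b, e)` (`c ≤ d − 1`) is the `F`-exponent **`E(c,a,b,e) = (a+n+1)·j + (b+n+1)·i + (e+w)·u + (d−1−c)·f`** (degree `a + b + e + p + n + 1 − c`).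
For ONE pure corner step `s′ = CentreBlowup.step p univ j 0 s`:
* §1 `gameExp_degree_sigma`, **`chartExponent_gameExp_sigma`** — Hironaka's corner map IS the rule `(c,a,b,e) ↦ (c, a+b+e−c, b, e)` for every
  prime AND EVERY σ (the `p = n + w + d` cancels); `dead_of_isPthPowerExponent_gameExp_sigma` — cleaning deletes DEAD monomials only
  (`c ≤ a + e ∧ c ≤ b + e`).
* §2 **`coeff_step_zero_gameExp_sigma`** (FORWARD law, exact), `le_of_coeff_gameExp_ne_zero_sigma` (no truncation on a straight state of order
  `p + n`), `coeff_step_zero_gameExp_ne_zero_sigma`, **`exists_parent_of_coeff_step_zero_gameExp_sigma`** (BACKWARD law with the ledger exception: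
  a parent of `j`-exponent exactly `n`), `exists_parent_of_coeff_step_zero_gameExp_of_ledger_sigma`.
* §3 `degree_le_degree_chartExponent_add_sigma`, **`ledger_step_zero_sigma`** — exact ledger transport «`f`-degree `≤ d − 1` ⇒ slot exponents
  `≥ n + 1`».
eng-w5's (U) in these letters: relabel `m′_c = |m| − d` ✓ (§1), legality blocker «slot exponent ≥ twice the excess degree» = the game's blocker,
dead = cleaning ✓ (§1).  The light pair (p712468) is the instance `n = 1, w = 0`.
[cite: CossartJannsenSaito2020, Lemma 13.2, Thm. 3.14] [cite: Hauser2010, §§F–G]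
bears_on: LADDER-RESOLUTION:D157-DOOR2 (res-dim4-pi · K2(p) · power cones · two-slot game step every prime, every σ).  Supports
stmt-ResolutionOfSingularities-16155 (helper).
-/

set_option linter.dupNamespace false -- mandated namespace of this single-conjunct summit

noncomputable section

namespace Summit.ResolutionOfSingularities.ResolutionOfSingularities.Theorems.PIDim4

namespace ResCone

open MvPolynomial Finset
open Literature.AlgebraicGeometry.Resolution
open Literature.AlgebraicGeometry.Resolution.CentreBlowup
open Literature.AlgebraicGeometry.Resolution.Hauser2010
open Literature.AlgebraicGeometry.Resolution.HauserPerlega2019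

variable {K : Type} [Field K]

/-! ## 1. The game exponent `E(c,a,b,e) = (a+n+1)·j + (b+n+1)·i + (e+w)·u + (d−1−c)·f` and the corner map, every prime, every σ -/

section GameExp

variable {j i u f : Fin 4} (hji : j ≠ i) (hju : j ≠ u) (hjf : j ≠ f) (hiu : i ≠ u) (hif : i ≠ f) (huf : u ≠ f)
include hji hju hjf hiu hif huf

omit hji hju hjf hiu hif huf in
/-- Degree of the σ-game exponent: `|E(c,a,b,e)| = a + b + e + 2n + w + d + 1 − c` (`c + 1 ≤ d`). [OURS · bookkeeping] -/
theorem gameExp_degree_sigma {n w d c : ℕ} (hc : c + 1 ≤ d) (a b e : ℕ) :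
    (Finsupp.single j (a + n + 1) + Finsupp.single i (b + n + 1) + Finsupp.single u (e + w) + Finsupp.single f (d - 1 - c) :
      Fin 4 →₀ ℕ).degree = a + b + e + 2 * n + w + d + 1 - c := by
  rw [degree_quad j i u f]; omega

/-- **The corner map in σ-game coordinates, every prime, every σ**: in the chart of the slot `j` (`n + w + d = p`), the exponent `E(c,a,b,e)`
goes to `E(c, a+b+e−c, b, e)` — the rule does not see `(p, d, n, w)`; no truncation as soon as `c ≤ a + b + e`. [OURS]
[cite: CossartJannsenSaito2020, Lemma 13.2] -/
theorem chartExponent_gameExp_sigma (p : ℕ) {n w d : ℕ} (hσ : n + w + d = p) {c : ℕ} (hc : c + 1 ≤ d) {a b e : ℕ}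
    (hle : c ≤ a + b + e) :
    chartExponent p Finset.univ j
        (Finsupp.single j (a + n + 1) + Finsupp.single i (b + n + 1) + Finsupp.single u (e + w) + Finsupp.single f (d - 1 - c)) =
      Finsupp.single j (a + b + e - c + n + 1) + Finsupp.single i (b + n + 1) + Finsupp.single u (e + w) +
        Finsupp.single f (d - 1 - c) := by
  obtain ⟨h1, h2, h3, h4⟩ := quad_apply hji hju hjf hiu hif huf (a + n + 1) (b + n + 1) (e + w) (d - 1 - c)
  obtain ⟨h1', h2', h3', h4'⟩ := quad_apply hji hju hjf hiu hif huf (a + b + e - c + n + 1) (b + n + 1) (e + w) (d - 1 - c)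
  ext k
  rcases letters_exhaust hji hju hjf hiu hif huf k with h | h | h | h <;> rw [h]
  · rw [chartExponent_univ_apply_self, gameExp_degree_sigma (j := j) (i := i) (u := u) (f := f) hc, h1']; omega
  · rw [chartExponent_apply_of_ne p Finset.univ hji.symm, h2, h2']
  · rw [chartExponent_apply_of_ne p Finset.univ hju.symm, h3, h3']
  · rw [chartExponent_apply_of_ne p Finset.univ hjf.symm, h4, h4']

/-- **Cleaning touches DEAD monomials only, every prime, every σ**: a σ-game exponent all of whose entries are multiples of `p` has
`a + n + 1, b + n + 1 ≥ p`, hence `a, b ≥ w + d − 1 ≥ c`: it is dead (`c ≤ a + e ∧ c ≤ b + e`). [OURS] -/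
theorem dead_of_isPthPowerExponent_gameExp_sigma (p : ℕ) {n w d : ℕ} (hσ : n + w + d = p) {c : ℕ} (hc : c + 1 ≤ d)
    {a b e : ℕ}
    (h : IsPthPowerExponent p
      (Finsupp.single j (a + n + 1) + Finsupp.single i (b + n + 1) + Finsupp.single u (e + w) + Finsupp.single f (d - 1 - c) :
        Fin 4 →₀ ℕ)) : c ≤ a + e ∧ c ≤ b + e := by
  obtain ⟨h1, h2, -, -⟩ := quad_apply hji hju hjf hiu hif huf (a + n + 1) (b + n + 1) (e + w) (d - 1 - c)
  unfold IsPthPowerExponent at h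
  have hj' := h j (by rw [Finsupp.mem_support_iff, h1]; omega)
  have hi' := h i (by rw [Finsupp.mem_support_iff, h2]; omega)
  rw [h1] at hj'
  rw [h2] at hi'
  have hja : p ≤ a + n + 1 := Nat.le_of_dvd (by omega) hj'
  have hib : p ≤ b + n + 1 := Nat.le_of_dvd (by omega) hi'
  constructor <;> omega

end GameExp

/-! ## 2. One pure corner step: the forward and backward laws in σ-game coordinates, every prime -/

section Step

variable [DecidableEq K]
variable {j i u f : Fin 4} (hji : j ≠ i) (hju : j ≠ u) (hjf : j ≠ f) (hiu : i ≠ u) (hif : i ≠ f) (huf : u ≠ f)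
include hji hju hjf hiu hif huf

/-- **FORWARD LAW, every prime, every σ** (exact transport, any degree): at a pure corner step in the chart of the slot `j`, the coefficient
of the LIVE image `E(c, a+b+e−c, b, e)` in the child equals the coefficient of `E(c,a,b,e)` in the parent. [OURS] [cite: Hauser2010, §§F–G] -/
theorem coeff_step_zero_gameExp_sigma (p : ℕ) {n w d : ℕ} (hσ : n + w + d = p) (s : State K)
    (hq : ((p : ℕ) : ℕ∞) ≤ ordAlong Finset.univ s.F) {c : ℕ} (hc : c + 1 ≤ d) {a b e : ℕ} (hle : c ≤ a + b + e)
    (hlive : ¬ (c ≤ (a + b + e - c) + e ∧ c ≤ b + e)) :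
    coeff (Finsupp.single j (a + b + e - c + n + 1) + Finsupp.single i (b + n + 1) + Finsupp.single u (e + w) +
        Finsupp.single f (d - 1 - c)) (CentreBlowup.step p Finset.univ j 0 s).F =
      coeff (Finsupp.single j (a + n + 1) + Finsupp.single i (b + n + 1) + Finsupp.single u (e + w) + Finsupp.single f (d - 1 - c))
        s.F := by
  have he : p ≤ (Finsupp.single j (a + n + 1) + Finsupp.single i (b + n + 1) + Finsupp.single u (e + w) +
      Finsupp.single f (d - 1 - c) : Fin 4 →₀ ℕ).degree := by
    rw [gameExp_degree_sigma (j := j) (i := i) (u := u) (f := f) hc]; omega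
  rw [← chartExponent_gameExp_sigma hji hju hjf hiu hif huf p hσ hc hle, coeff_step_zero_chartExponent p j s hq he, if_neg]
  intro hp
  rw [chartExponent_gameExp_sigma hji hju hjf hiu hif huf p hσ hc hle] at hp
  exact hlive (dead_of_isPthPowerExponent_gameExp_sigma hji hju hjf hiu hif huf p hσ hc hp)

omit [DecidableEq K] in
/-- A PRESENT σ-game monomial of a state of order `≥ p + n` whose only degree-`(p + n)` monomials have `f`-exponent `d` (straight power cone
`x^r·f^d`) satisfies `c ≤ a + b + e` (no truncation in the corner map). [OURS] -/
theorem le_of_coeff_gameExp_ne_zero_sigma {p n w d : ℕ} (hσ : n + w + d = p) (s : State K)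
    (h6 : ∀ e ∈ s.F.support, p + n ≤ e.degree) (hstraight : ∀ e ∈ s.F.support, e.degree = p + n → e f = d) {c : ℕ}
    (hc : c + 1 ≤ d) {a b e : ℕ}
    (h : coeff (Finsupp.single j (a + n + 1) + Finsupp.single i (b + n + 1) + Finsupp.single u (e + w) +
      Finsupp.single f (d - 1 - c)) s.F ≠ 0) : c ≤ a + b + e := by
  have hmem := mem_support_iff.mpr h
  have hdeg := h6 _ hmem
  rw [gameExp_degree_sigma (j := j) (i := i) (u := u) (f := f) hc] at hdeg
  by_contra hlt
  have hdeg6 : (Finsupp.single j (a + n + 1) + Finsupp.single i (b + n + 1) + Finsupp.single u (e + w) +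
      Finsupp.single f (d - 1 - c) : Fin 4 →₀ ℕ).degree = p + n := by
    rw [gameExp_degree_sigma (j := j) (i := i) (u := u) (f := f) hc]; omega
  have hf4 := hstraight _ hmem hdeg6
  rw [(quad_apply hji hju hjf hiu hif huf (a + n + 1) (b + n + 1) (e + w) (d - 1 - c)).2.2.2] at hf4
  omega

/-- **FORWARD LAW for present monomials, every prime, every σ**: a present game monomial of a straight state with live image has its image
present at the child. [OURS] -/
theorem coeff_step_zero_gameExp_ne_zero_sigma (p : ℕ) {n w d : ℕ} (hσ : n + w + d = p) (s : State K)
    (hq : ((p : ℕ) : ℕ∞) ≤ ordAlong Finset.univ s.F) (h6 : ∀ e ∈ s.F.support, p + n ≤ e.degree)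
    (hstraight : ∀ e ∈ s.F.support, e.degree = p + n → e f = d) {c : ℕ} (hc : c + 1 ≤ d) {a b e : ℕ}
    (h : coeff (Finsupp.single j (a + n + 1) + Finsupp.single i (b + n + 1) + Finsupp.single u (e + w) +
      Finsupp.single f (d - 1 - c)) s.F ≠ 0) (hlive : ¬ (c ≤ (a + b + e - c) + e ∧ c ≤ b + e)) :
    coeff (Finsupp.single j (a + b + e - c + n + 1) + Finsupp.single i (b + n + 1) + Finsupp.single u (e + w) +
        Finsupp.single f (d - 1 - c)) (CentreBlowup.step p Finset.univ j 0 s).F ≠ 0 := by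
  rw [coeff_step_zero_gameExp_sigma hji hju hjf hiu hif huf p hσ s hq hc
    (le_of_coeff_gameExp_ne_zero_sigma hji hju hjf hiu hif huf hσ s h6 hstraight hc h) hlive]
  exact h

/-- **BACKWARD LAW, every prime, every σ** (live branch, ledger exception explicit): a σ-game monomial `E(c, a′, b, e)` present at the pure-corner
child in the chart of `j` is the image of a parent monomial with the same `(c, b, e)`: either a game monomial `E(c, a₀, b, e)` with
`a′ + c = a₀ + b + e`, or the LEDGER EXCEPTION — a parent monomial of `j`-exponent exactly `n`, `f`-degree `d − 1 − c`, and `a′ + 1 + c = b + e`.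
[OURS] [cite: CossartJannsenSaito2020, Lemma 13.2] -/
theorem exists_parent_of_coeff_step_zero_gameExp_sigma (p : ℕ) {n w d : ℕ} (hσ : n + w + d = p) (s : State K)
    (hrn : ∀ e ∈ s.F.support, n ≤ e j) {c : ℕ} (hc : c + 1 ≤ d) {a' b e : ℕ}
    (h : coeff (Finsupp.single j (a' + n + 1) + Finsupp.single i (b + n + 1) + Finsupp.single u (e + w) +
      Finsupp.single f (d - 1 - c)) (CentreBlowup.step p Finset.univ j 0 s).F ≠ 0) :
    (∃ a₀, coeff (Finsupp.single j (a₀ + n + 1) + Finsupp.single i (b + n + 1) + Finsupp.single u (e + w) +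
        Finsupp.single f (d - 1 - c)) s.F ≠ 0 ∧ a' + c = a₀ + b + e) ∨
      (coeff (Finsupp.single j n + Finsupp.single i (b + n + 1) + Finsupp.single u (e + w) + Finsupp.single f (d - 1 - c))
          s.F ≠ 0 ∧ a' + 1 + c = b + e) := by
  obtain ⟨m, hm, hmE⟩ := exists_of_mem_support_step_zero j s (mem_support_iff.mpr h)
  obtain ⟨h1, h2, h3, h4⟩ := quad_apply hji hju hjf hiu hif huf (a' + n + 1) (b + n + 1) (e + w) (d - 1 - c)
  have hmi : m i = b + n + 1 := by rw [← chartExponent_apply_of_ne p Finset.univ hji.symm m, hmE, h2]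
  have hmu : m u = e + w := by rw [← chartExponent_apply_of_ne p Finset.univ hju.symm m, hmE, h3]
  have hmf : m f = d - 1 - c := by rw [← chartExponent_apply_of_ne p Finset.univ hjf.symm m, hmE, h4]
  have hmj : m.degree - p = a' + n + 1 := by rw [← chartExponent_univ_apply_self p j m, hmE, h1]
  have hdeg := degree_eq_quad hji hju hjf hiu hif huf m
  rw [hmi, hmu, hmf] at hdeg
  have hm1 := hrn m hm
  have hmq := eq_sum_single_four hji hju hjf hiu hif huf m
  rw [hmi, hmu, hmf] at hmq
  by_cases hj2 : n + 1 ≤ m j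
  · refine Or.inl ⟨m j - (n + 1), ?_, by omega⟩
    rw [show m j - (n + 1) + n + 1 = m j by omega, ← hmq]
    exact mem_support_iff.mp hm
  · have hj1 : m j = n := by omega
    refine Or.inr ⟨?_, by omega⟩
    rw [hj1] at hmq
    rw [← hmq]
    exact mem_support_iff.mp hm

/-- **BACKWARD LAW under the EXACT ledger reading, every prime, every σ**: if every parent monomial of `f`-degree `≤ d − 1` has `j`-exponent
`≥ n + 1` (the pair-ledger divisibility of a straight frame), then a child game monomial `E(c, a′, b, e)` has a GAME parent `E(c, a₀, b, e)` with
`a′ + c = a₀ + b + e`. [OURS] -/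
theorem exists_parent_of_coeff_step_zero_gameExp_of_ledger_sigma (p : ℕ) {n w d : ℕ} (hσ : n + w + d = p) (s : State K)
    (hrn : ∀ e ∈ s.F.support, n ≤ e j) (hled : ∀ e ∈ s.F.support, e f ≤ d - 1 → n + 1 ≤ e j) {c : ℕ} (hc : c + 1 ≤ d)
    {a' b e : ℕ}
    (h : coeff (Finsupp.single j (a' + n + 1) + Finsupp.single i (b + n + 1) + Finsupp.single u (e + w) +
      Finsupp.single f (d - 1 - c)) (CentreBlowup.step p Finset.univ j 0 s).F ≠ 0) :
    ∃ a₀, coeff (Finsupp.single j (a₀ + n + 1) + Finsupp.single i (b + n + 1) + Finsupp.single u (e + w) +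
        Finsupp.single f (d - 1 - c)) s.F ≠ 0 ∧ a' + c = a₀ + b + e := by
  rcases exists_parent_of_coeff_step_zero_gameExp_sigma hji hju hjf hiu hif huf p hσ s hrn hc h with h' | ⟨h', -⟩
  · exact h'
  · exfalso
    obtain ⟨h1, -, -, h4⟩ := quad_apply hji hju hjf hiu hif huf n (b + n + 1) (e + w) (d - 1 - c)
    have hmem := mem_support_iff.mpr h'
    have h2j := hled _ hmem (by rw [h4]; omega)
    rw [h1] at h2j
    omega

/-! ## 3. Exact transport of the ledger reading through a pure corner step, every prime, every σ -/

/-- Degree bookkeeping of the corner map: a child monomial has degree at least its parent's degree minus `d` (the kept slot `i` carries `≥ n` and the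
passive letter `≥ w`). [OURS · bookkeeping] -/
theorem degree_le_degree_chartExponent_add_sigma (p : ℕ) {n w d : ℕ} (hσ : n + w + d = p) {m : Fin 4 →₀ ℕ}
    (hp : p ≤ m.degree) (hin : n ≤ m i) (huw : w ≤ m u) :
    m.degree ≤ (chartExponent p Finset.univ j m).degree + d := by
  have hdeg := degree_eq_quad hji hju hjf hiu hif huf m
  have hdeg' := degree_eq_quad hji hju hjf hiu hif huf (chartExponent p Finset.univ j m)
  rw [chartExponent_univ_apply_self, chartExponent_apply_of_ne p Finset.univ hji.symm,
    chartExponent_apply_of_ne p Finset.univ hju.symm, chartExponent_apply_of_ne p Finset.univ hjf.symm] at hdeg'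
  omega

/-- **EXACT LEDGER TRANSPORT, every prime, every σ**: if every parent monomial of `f`-degree `≤ d − 1` has both slot exponents `≥ n + 1` and degree
`≥ p + n + 1` (the straight initial monomial `x^r f^d` is the only one of degree `p + n`), then the slot divisibility holds at the pure-corner child
in the chart of `j`. [OURS] -/
theorem ledger_step_zero_sigma (p : ℕ) {n w d : ℕ} (hσ : n + w + d = p) (s : State K)
    (hpass : ∀ e ∈ s.F.support, w ≤ e u)
    (h7 : ∀ e ∈ s.F.support, e f ≤ d - 1 → p + n + 1 ≤ e.degree)
    (hled : ∀ e ∈ s.F.support, e f ≤ d - 1 → n + 1 ≤ e j ∧ n + 1 ≤ e i) :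
    ∀ e' ∈ (CentreBlowup.step p Finset.univ j 0 s).F.support, e' f ≤ d - 1 → n + 1 ≤ e' j ∧ n + 1 ≤ e' i := by
  intro e' he' hf'
  obtain ⟨m, hm, hmE⟩ := exists_of_mem_support_step_zero j s he'
  subst hmE
  rw [chartExponent_apply_of_ne p Finset.univ hjf.symm] at hf'
  have hdeg7 := h7 m hm hf'
  have h2 := hled m hm hf'
  have hw' := hpass m hm
  have hdeg := degree_eq_quad hji hju hjf hiu hif huf m
  rw [chartExponent_univ_apply_self, chartExponent_apply_of_ne p Finset.univ hji.symm]
  exact ⟨by omega, h2.2⟩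

end Step

end ResCone

end Summit.ResolutionOfSingularities.ResolutionOfSingularities.Theorems.PIDim4

end
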